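import Mathlib.NumberTheory.SelbergSieve
import Mathlib.NumberTheory.PrimeCounting
import Mathlib.NumberTheory.Primorial
import Mathlib.NumberTheory.ArithmeticFunction.Misc
import Mathlib.Analysis.SpecialFunctions.Pow.Real
import Literature.NumberTheory.Sieve.LevelOfDistribution
import HarnessLib

-- provenance: harness21/H21/H21/Prelude/AntSieve/SieveFramework.lean @ f7a6f2c (interim HEAD d8f2665); M5 mechanical rewrite
/-!
# Sieve framework beyond Mathlib's `SelbergSieve`, part 1

Trunk `AntSieve`, item C13 (`sieve_framework`, part 1; OUTLINE D-SIEVE-4).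

Mathlib (`Mathlib.NumberTheory.SelbergSieve`, following Heath-Brown's lecture notes) provides the
finite sieve set-up `BoundingSieve` / `SelbergSieve` and, in `namespace BoundingSieve`, the API
`siftedSum`, `multSum`, `rem`, `mainSum`, `errSum`, `lambdaSquared`, `selbergTerms` (Heath-Brown's `g`)
and the diagonalisation of the `Λ²` main term. It also has `Nat.primesBelow`, `primorial`
(`squarefree_primorial`), and `IsMultiplicative.prodPrimeFactors_one_sub_of_squarefree`
(`∏_{p ∣ P} (1 − g p) = ∑_{d ∣ P} μ(d) g(d)`). We USE all of these and only add:

* `primesProdBelow z = P(z) = ∏_{p < z} p` (`= primorial (⌈z⌉₊ − 1)`, `primesProdBelow_eq_primorial`);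
* the bridge `SieveSequence.toBoundingSieve` from the infinite-sequence layer of
  `Literature.Prelude.AntSieve.LevelOfDistribution` (support `Ioc 0 ⌊x⌋₊`, weights `a`, total mass `X(x)`,
  `ν = g`; the two positivity fields of `BoundingSieve` ARE the hypothesis `A.IsSiftable P`);
* the hypothesis-free sifting function `SieveSequence.sifted A x P = S(𝒜, P; x)`, the product
  `SieveSequence.densityProduct A P = V(P) = ∏_{p ∣ P} (1 − g(p))`, the sub-sequence
  `SieveSequence.restrictDvd A p = 𝒜_p` and the finite Buchstab identity;
* the sieve-dimension condition `HasSieveDimension g κ K` (Iwaniec's `Ω(κ)`,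
  Friedlander–Iwaniec (5.38)/(6.32), Halberstam–Richert `Ω₂(κ)`);
* in `namespace SelbergSieve` (a DELIBERATE dot-notation extension of Mathlib's structure, holding only
  the level-dependent additions): `selbergSum S = G(√D)` and Selberg's `Λ²` upper bound
  `S ≤ X / G(√D) + ∑_{d ≤ D, d ∣ P} 3^{ω(d)} |R_d|` (Heath-Brown Thm 5; Friedlander–Iwaniec Thm 7.1);
* the Fundamental Lemma of sieve theory in the `exp(−s)` shape (Halberstam–Richert Thm 2.5;
  Friedlander–Iwaniec Lemma 6.8, Thm 6.9, Cor 6.10) and the dimension-`1` property of the shifted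
  primes (Mertens).

## References

* H. Halberstam, H.-E. Richert, *Sieve Methods* (1974), Ch. 1–2, 7.
* J. Friedlander, H. Iwaniec, *Opera de Cribro* (2010), §5–7, §11.
* D. R. Heath-Brown, *Lectures on sieves* (2002) (the Mathlib reference).

## Design notes

* `SieveSequence.toBoundingSieve_rem` and `SieveSequence.densityProduct_pos` hold without the
  divisibility / squarefreeness hypotheses suggested in the outline, so these are omitted.
* The Fundamental Lemma is stated uniformly in the sequence (`fundamental_lemma_uniform`: the constant
  depends on `κ, K` only, as in the literature); the outline's per-sequence form
  `SieveSequence.fundamental_lemma` is derived from it. The hypothesis `A.IsSiftable (P z)` of the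
  outline is NOT assumed: Friedlander–Iwaniec §6 only need `0 ≤ g(p) < 1` (part of
  `HasSieveDimension`), and `IsSiftable` fails for the shifted primes (`g 2 = 0`), the main client.
* `restrictDvd A p` keeps the density `g` and rescales the size to `g(p) X`; this is the correct model
  of `𝒜_p` for moduli `d` coprime to `p` (`restrictDvd_congrSum`), which is all the Buchstab iteration
  uses (documented at the definition).
-/

open Finset
open scoped ArithmeticFunction.Moebius ArithmeticFunction.omega ArithmeticFunction.vonMangoldt

noncomputable section

namespace Literature.NumberTheory.Sieve

/-! ### `P(z) = ∏_{p < z} p` -/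

/-- `primesProdBelow z = P(z) = ∏_{p < z} p`, the product of the primes strictly below the real
number `z` (Halberstam–Richert Ch. 1, (1.9); Friedlander–Iwaniec (6.1)). Here `p < z ↔ p < ⌈z⌉₊`
(`Nat.lt_ceil`), so this is `∏ p ∈ Nat.primesBelow ⌈z⌉₊, p = primorial (⌈z⌉₊ − 1)`. [folklore] -/
def primesProdBelow (z : ℝ) : ℕ :=
  ∏ p ∈ Nat.primesBelow ⌈z⌉₊, p

/-- `P(z) = primorial (⌈z⌉₊ − 1)` (Mathlib's `primorial n = ∏_{p ≤ n} p`). [folklore] -/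
theorem primesProdBelow_eq_primorial (z : ℝ) : primesProdBelow z = primorial (⌈z⌉₊ - 1) := by
  rw [primesProdBelow, Nat.primesBelow_eq_primesLE_sub_one]
  rfl

/-- `P(n + 1) = primorial n` for a natural number `n`. [folklore] -/
theorem primesProdBelow_natCast_add_one (n : ℕ) :
    primesProdBelow ((n + 1 : ℕ) : ℝ) = primorial n := by
  rw [primesProdBelow_eq_primorial, Nat.ceil_natCast, Nat.add_sub_cancel]

/-- `P(z)` is squarefree (a product of distinct primes; compare `squarefree_primorial`). [folklore] -/
theorem squarefree_primesProdBelow (z : ℝ) : Squarefree (primesProdBelow z) := by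
  rw [primesProdBelow_eq_primorial]
  exact squarefree_primorial _

/-- `P(z) ≠ 0`. [folklore] -/
theorem primesProdBelow_ne_zero (z : ℝ) : primesProdBelow z ≠ 0 :=
  (squarefree_primesProdBelow z).ne_zero

/-- The prime factors of `P(z)` are exactly the primes `< z`. [folklore] -/
theorem primeFactors_primesProdBelow (z : ℝ) :
    (primesProdBelow z).primeFactors = Nat.primesBelow ⌈z⌉₊ :=
  Nat.primeFactors_prod fun _ hp => Nat.prime_of_mem_primesBelow hp

/-- A prime `p` divides `P(z)` iff `p < z`. [folklore] -/
theorem dvd_primesProdBelow_iff {p : ℕ} (hp : p.Prime) (z : ℝ) :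
    p ∣ primesProdBelow z ↔ (p : ℝ) < z := by
  have h := Nat.mem_primeFactors_of_ne_zero (primesProdBelow_ne_zero z) (p := p)
  rw [primeFactors_primesProdBelow, Nat.mem_primesBelow] at h
  rw [← Nat.lt_ceil]
  exact ⟨fun hd => (h.mpr ⟨hp, hd⟩).1, fun hl => (h.mp ⟨hl, hp⟩).2⟩

/-- `(n, P(z)) = 1` iff no prime `q < z` divides `n` (elementary). [folklore] -/
theorem coprime_primesProdBelow_iff (n : ℕ) (z : ℝ) :
    n.Coprime (primesProdBelow z) ↔ ∀ q ∈ Nat.primesBelow ⌈z⌉₊, ¬ q ∣ n := by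
  rw [primesProdBelow, Nat.coprime_prod_right_iff]
  refine forall₂_congr fun q hq => ?_
  rw [Nat.coprime_comm, (Nat.prime_of_mem_primesBelow hq).coprime_iff_not_dvd]

/-! ### From sifted sequences to Mathlib's `BoundingSieve` -/

namespace SieveSequence

variable (A : SieveSequence)

/-- The finite sieve problem attached to a sifted sequence `A` at height `x` with sifting range the
squarefree number `P` (OUTLINE D-SIEVE-4): support `{1, …, ⌊x⌋}`, weights `a_n`, total mass `X(x)`,
`ν = g`. The fields `nu_pos_of_prime`, `nu_lt_one_of_prime` of Mathlib's `BoundingSieve` are exactly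
the hypothesis `h : A.IsSiftable P` (Halberstam–Richert Ch. 1, (Ω₁); Heath-Brown §1). [folklore] -/
def toBoundingSieve (x : ℝ) {P : ℕ} (hP : Squarefree P) (h : A.IsSiftable P) : BoundingSieve where
  support := Ioc 0 ⌊x⌋₊
  prodPrimes := P
  prodPrimes_squarefree := hP
  weights := A.a
  weights_nonneg := A.a_nonneg
  totalMass := A.size x
  nu := A.density
  nu_mult := A.density_mult
  nu_pos_of_prime p hp hd := (h p hp hd).1
  nu_lt_one_of_prime p hp hd := (h p hp hd).2

/-- The sifting function `S(𝒜, P; x) = ∑_{n ≤ x, (n, P) = 1} a_n` (Halberstam–Richert Ch. 1, (1.10);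
Friedlander–Iwaniec (6.2)). Hypothesis-free; it agrees with Mathlib's `BoundingSieve.siftedSum` of
`A.toBoundingSieve x hP h` (`siftedSum_toBoundingSieve`). `S(𝒜, z)` is `A.sifted x (primesProdBelow z)`. [folklore] -/
def sifted (x : ℝ) (P : ℕ) : ℝ :=
  ∑ n ∈ (Ioc 0 ⌊x⌋₊).filter (fun n : ℕ => n.Coprime P), A.a n

/-- With `P = 1` nothing is sifted: `S(𝒜, 1; x) = ∑_{n ≤ x} a_n`. [folklore] -/
theorem sifted_one (x : ℝ) : A.sifted x 1 = ∑ n ∈ Ioc 0 ⌊x⌋₊, A.a n := by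
  rw [sifted, Finset.filter_true_of_mem fun n _ => Nat.coprime_one_right n]

/-- Mathlib's sifted sum of the attached `BoundingSieve` is `S(𝒜, P; x)` (unfolding
`BoundingSieve.siftedSum`). [folklore] -/
theorem siftedSum_toBoundingSieve (x : ℝ) {P : ℕ} (hP : Squarefree P) (h : A.IsSiftable P) :
    (A.toBoundingSieve x hP h).siftedSum = A.sifted x P := by
  rw [BoundingSieve.siftedSum, sifted, Finset.sum_filter]
  refine Finset.sum_congr rfl fun n _ => ?_
  change (if P.Coprime n then A.a n else 0) = if n.Coprime P then A.a n else 0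
  by_cases hc : n.Coprime P
  · rw [if_pos hc, if_pos hc.symm]
  · rw [if_neg hc, if_neg fun h' => hc h'.symm]

/-- Mathlib's remainder `BoundingSieve.rem` of the attached `BoundingSieve` is `R_d(x)`
(`SieveSequence.remainder`); this holds for every `d` (no divisibility hypothesis is needed). [folklore] -/
theorem toBoundingSieve_rem (x : ℝ) {P : ℕ} (hP : Squarefree P) (h : A.IsSiftable P) (d : ℕ) :
    (A.toBoundingSieve x hP h).rem d = A.remainder d x := by
  simp [BoundingSieve.rem, BoundingSieve.multSum, toBoundingSieve, remainder, congrSum,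
    Finset.sum_filter]

/-- For indicator weights `a = 1_S`, the sifting function counts: `S(𝒜, P; x) = #{n ≤ x : n ∈ S,
(n, P) = 1}` (Halberstam–Richert Ch. 1, (1.10) with `𝒜` a set). [folklore] -/
theorem sifted_eq_card (S : Set ℕ) [DecidablePred (· ∈ S)]
    (hS : ∀ n, A.a n = if n ∈ S then 1 else 0) (x : ℝ) (P : ℕ) :
    A.sifted x P = #{n ∈ Ioc 0 ⌊x⌋₊ | n ∈ S ∧ n.Coprime P} := by
  simp only [sifted, hS, Finset.sum_boole, Finset.filter_filter]
  congr 2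
  ext n
  simp only [Finset.mem_filter, and_congr_right_iff]
  exact fun _ => and_comm

/-! ### `V(P) = ∏_{p ∣ P} (1 − g(p))` -/

/-- `A.densityProduct P = V(P) = ∏_{p ∣ P} (1 − g(p))` (Halberstam–Richert Ch. 1, (1.11) `W(z)`;
Friedlander–Iwaniec (6.4)); `V(z) = A.densityProduct (primesProdBelow z)`. [folklore] -/
def densityProduct (P : ℕ) : ℝ :=
  ∏ p ∈ P.primeFactors, (1 - A.density p)

/-- `V(P) > 0` as soon as `g(p) < 1` on the primes dividing `P` (in particular under
`A.IsSiftable P`). [folklore] -/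
theorem densityProduct_pos {P : ℕ} (h : A.IsSiftable P) : 0 < A.densityProduct P :=
  Finset.prod_pos fun p hp =>
    sub_pos.mpr (h p (Nat.prime_of_mem_primeFactors hp) (Nat.dvd_of_mem_primeFactors hp)).2

/-- `V(P) = ∑_{d ∣ P} μ(d) g(d)` for squarefree `P` (Mathlib's
`IsMultiplicative.prodPrimeFactors_one_sub_of_squarefree`; Halberstam–Richert Ch. 1, (1.12)). [folklore] -/
theorem densityProduct_eq_sum_moebius {P : ℕ} (hP : Squarefree P) :
    A.densityProduct P = ∑ d ∈ P.divisors, (μ d : ℝ) * A.density d :=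
  ArithmeticFunction.IsMultiplicative.prodPrimeFactors_one_sub_of_squarefree _ A.density_mult hP

/-- `V(P)` is Mathlib's main sum `BoundingSieve.mainSum μ` of the attached sieve (the
Legendre/Eratosthenes main term; Heath-Brown §1). [folklore] -/
theorem densityProduct_eq_mainSum_moebius (x : ℝ) {P : ℕ} (hP : Squarefree P)
    (h : A.IsSiftable P) :
    A.densityProduct P = (A.toBoundingSieve x hP h).mainSum fun d => (μ d : ℝ) := by
  rw [densityProduct_eq_sum_moebius A hP]
  rfl

/-! ### The sub-sequence `𝒜_p` and the Buchstab identity -/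

/-- `A.restrictDvd p = 𝒜_p`, the sub-sequence of terms divisible by `p`: `a n ↦ 1_{p ∣ n} a_n`, size
`X_p(x) = g(p) X(x)`, and the SAME density `g` (Halberstam–Richert Ch. 2, §1 and Ch. 7, (1.6);
Friedlander–Iwaniec (6.8)). Design choice: since `(𝒜_p)_d = 𝒜_{pd}` only for `(d, p) = 1`
(`restrictDvd_congrSum`), the density `g` (rather than `d ↦ g(lcm(p,d))/g(p)`) models `𝒜_p` exactly
on the moduli coprime to `p`, which is all that Buchstab iteration (sifting `𝒜_p` by the primes
`< p`) uses. [folklore] -/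
def restrictDvd (p : ℕ) : SieveSequence where
  a n := if p ∣ n then A.a n else 0
  a_nonneg n := by
    split_ifs
    exacts [A.a_nonneg n, le_rfl]
  size x := A.density p * A.size x
  density := A.density
  density_mult := A.density_mult

/-- Unfolding lemma for the terms of `𝒜_p` (definition). [folklore] -/
@[simp]
theorem restrictDvd_a (p n : ℕ) : (A.restrictDvd p).a n = if p ∣ n then A.a n else 0 := rfl

/-- `(𝒜_p)_d(x) = 𝒜_{pd}(x)` for `(p, d) = 1` (Halberstam–Richert Ch. 2, §1). [folklore] -/
theorem restrictDvd_congrSum {p d : ℕ} (hpd : p.Coprime d) (x : ℝ) :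
    (A.restrictDvd p).congrSum d x = A.congrSum (p * d) x := by
  simp only [congrSum, Finset.sum_filter, restrictDvd_a]
  refine Finset.sum_congr rfl fun n _ => ?_
  rcases em (p * d ∣ n) with h | h
  · rw [if_pos ((dvd_mul_left d p).trans h), if_pos ((dvd_mul_right p d).trans h), if_pos h]
  · rw [if_neg h]
    by_cases hd : d ∣ n
    · rw [if_pos hd, if_neg]
      exact fun hp => h (hpd.mul_dvd_of_dvd_of_dvd hp hd)
    · rw [if_neg hd]

/-- The (finite) **Buchstab identity** (Halberstam–Richert Ch. 7, (1.12); Friedlander–Iwaniec (6.11)):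
`S(𝒜, z) = |𝒜| − ∑_{p < z} S(𝒜_p, p)`, i.e.
`∑_{n ≤ x, (n, P(z)) = 1} a_n = ∑_{n ≤ x} a_n − ∑_{p < z} ∑_{n ≤ x, p ∣ n, (n, P(p)) = 1} a_n`
(classify `n` with `(n, P(z)) ≠ 1` by its least prime factor `p = Nat.minFac n < z`). A finite
identity, valid for every sequence; proved here. [folklore] -/
theorem buchstab_identity (x z : ℝ) :
    A.sifted x (primesProdBelow z) =
      (∑ n ∈ Ioc 0 ⌊x⌋₊, A.a n) -
        ∑ p ∈ Nat.primesBelow ⌈z⌉₊, (A.restrictDvd p).sifted x (primesProdBelow p) := by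
  rw [eq_sub_iff_add_eq, sifted, ← Finset.sum_filter_add_sum_filter_not (Ioc 0 ⌊x⌋₊)
    (fun n : ℕ => n.Coprime (primesProdBelow z)) A.a]
  congr 1
  -- membership of `minFac n` in the sifting range, for `n` not coprime to `P(z)`
  have hminmem : ∀ n : ℕ, ¬ n.Coprime (primesProdBelow z) → n.minFac ∈ Nat.primesBelow ⌈z⌉₊ := by
    intro n hn
    rw [coprime_primesProdBelow_iff] at hn
    simp only [not_forall, not_not] at hn
    obtain ⟨q, hq, hqn⟩ := hn
    rw [Nat.mem_primesBelow] at hq ⊢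
    have hn1 : n ≠ 1 := fun h1 => hq.2.ne_one (Nat.dvd_one.mp (h1 ▸ hqn))
    exact ⟨(Nat.minFac_le_of_dvd hq.2.two_le hqn).trans_lt hq.1, Nat.minFac_prime hn1⟩
  have key : ∀ p ∈ Nat.primesBelow ⌈z⌉₊, (A.restrictDvd p).sifted x (primesProdBelow p) =
      ∑ n ∈ Ioc 0 ⌊x⌋₊,
        if ¬ n.Coprime (primesProdBelow z) ∧ n.minFac = p then A.a n else 0 := by
    intro p hp
    have hpp : p.Prime := Nat.prime_of_mem_primesBelow hp
    rw [sifted, Finset.sum_filter]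
    refine Finset.sum_congr rfl fun n _ => ?_
    simp only [restrictDvd_a]
    have hcp : n.Coprime (primesProdBelow p) ↔ ∀ q ∈ Nat.primesBelow p, ¬ q ∣ n := by
      rw [coprime_primesProdBelow_iff, Nat.ceil_natCast]
    by_cases H : ¬ n.Coprime (primesProdBelow z) ∧ n.minFac = p
    · obtain ⟨H1, rfl⟩ := H
      have hgood : n.Coprime (primesProdBelow (n.minFac : ℕ)) := by
        refine hcp.mpr fun q hq hqn => ?_
        rw [Nat.mem_primesBelow] at hq
        exact (Nat.not_lt.mpr (Nat.minFac_le_of_dvd hq.2.two_le hqn)) hq.1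
      rw [if_pos hgood, if_pos (Nat.minFac_dvd n), if_pos (show ¬ _ ∧ _ from ⟨H1, rfl⟩)]
    · rw [if_neg H]
      split_ifs with h1 h2 <;> try rfl
      exfalso
      apply H
      have hn1 : n ≠ 1 := fun h => hpp.ne_one (Nat.dvd_one.mp (h ▸ h2))
      have hmin : n.minFac = p := by
        rcases (Nat.minFac_le_of_dvd hpp.two_le h2).lt_or_eq with hlt | heq
        · exact absurd (Nat.minFac_dvd n)
            (hcp.mp h1 _ (Nat.mem_primesBelow.mpr ⟨hlt, Nat.minFac_prime hn1⟩))
        · exact heq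
      refine ⟨fun hc => ?_, hmin⟩
      rw [coprime_primesProdBelow_iff] at hc
      exact hc p hp h2
  rw [Finset.sum_congr rfl key, Finset.sum_comm, Finset.sum_filter]
  refine Finset.sum_congr rfl fun n _ => ?_
  by_cases hc : n.Coprime (primesProdBelow z)
  · simp [hc]
  · simp only [hc, not_false_eq_true, true_and, if_true]
    rw [Finset.sum_ite_eq (Nat.primesBelow ⌈z⌉₊) n.minFac (fun _ => A.a n), if_pos (hminmem n hc)]

end SieveSequence

/-! ### Sieve dimension -/

/-- `HasSieveDimension g κ K`: the density `g` has sieve dimension (at most) `κ` with constant `K`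
(Iwaniec's condition `Ω(κ)`; Friedlander–Iwaniec (5.38) = (6.32); Halberstam–Richert Ch. 2, `Ω₂(κ)`):
`0 ≤ g(p) < 1` for every prime `p`, and for all `2 ≤ w ≤ z`,
`∏_{w ≤ p < z} (1 − g(p))⁻¹ ≤ K (log z / log w)^κ`.
The clause `g p < 1` keeps `(1 − g p)⁻¹` free of the junk value `0⁻¹ = 0`; allowing `w = z` (empty
product) forces `1 ≤ K` (`HasSieveDimension.one_le`), as in Friedlander–Iwaniec where `K > 1`. [folklore] -/
def HasSieveDimension (g : ArithmeticFunction ℝ) (κ K : ℝ) : Prop :=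
  (∀ p : ℕ, p.Prime → 0 ≤ g p ∧ g p < 1) ∧
    ∀ w z : ℝ, 2 ≤ w → w ≤ z →
      ∏ p ∈ (Nat.primesBelow ⌈z⌉₊).filter (fun p : ℕ => w ≤ (p : ℝ)), (1 - g p)⁻¹ ≤
        K * (Real.log z / Real.log w) ^ κ

namespace HasSieveDimension

variable {g : ArithmeticFunction ℝ} {κ κ' K K' : ℝ}

/-- Under `Ω(κ)` with constant `K` one has `1 ≤ K` (take `w = z = 2`: the empty product is `1`). [folklore] -/
theorem one_le (h : HasSieveDimension g κ K) : 1 ≤ K := by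
  have h2 := h.2 2 2 le_rfl le_rfl
  have hlog : Real.log 2 ≠ 0 := (Real.log_pos one_lt_two).ne'
  have hempty : (Nat.primesBelow ⌈(2 : ℝ)⌉₊).filter (fun p : ℕ => (2 : ℝ) ≤ (p : ℝ)) = ∅ := by
    rw [Nat.ceil_ofNat, Nat.primesBelow_two, Finset.filter_empty]
  rwa [hempty, Finset.prod_empty, div_self hlog, Real.one_rpow, mul_one] at h2

/-- Monotonicity of the dimension condition: `Ω(κ)` with constant `K` implies `Ω(κ')` with constant
`K'` whenever `κ ≤ κ'` and `K ≤ K'` (since `log z / log w ≥ 1`; Friedlander–Iwaniec §5.5). [folklore] -/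
theorem mono (h : HasSieveDimension g κ K) (hκ : κ ≤ κ') (hK : K ≤ K') :
    HasSieveDimension g κ' K' := by
  refine ⟨h.1, fun w z hw hwz => (h.2 w z hw hwz).trans ?_⟩
  have hw1 : (1 : ℝ) < w := by linarith
  have h1 : 1 ≤ Real.log z / Real.log w := by
    rw [le_div_iff₀ (Real.log_pos hw1), one_mul]
    exact Real.log_le_log (by linarith) hwz
  have hK0 : 0 ≤ K' := zero_le_one.trans (h.one_le.trans hK)
  calc K * (Real.log z / Real.log w) ^ κ ≤ K' * (Real.log z / Real.log w) ^ κ :=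
        mul_le_mul_of_nonneg_right hK (Real.rpow_nonneg (zero_le_one.trans h1) _)
    _ ≤ K' * (Real.log z / Real.log w) ^ κ' :=
        mul_le_mul_of_nonneg_left (Real.rpow_le_rpow_of_exponent_le h1 hκ) hK0

end HasSieveDimension

/-! ### The Fundamental Lemma of sieve theory -/

/-- The **Fundamental Lemma** of sieve theory, uniform form (Friedlander–Iwaniec, *Opera de Cribro*,
Lemma 6.8, Thm 6.9, Cor 6.10; Halberstam–Richert Thm 2.5 and Thm 7.2). For every dimension `κ` and
constant `K` there is `C = C(κ, K) > 0` such that for every sifted sequence `𝒜` whose density satisfies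
`Ω(κ)` with constant `K`, all `x`, all `2 ≤ z ≤ D`, with `s = log D / log z` and `X = X(x) ≥ 0`,
`|S(𝒜, z; x) − X V(z)| ≤ C X V(z) e^{−s} + ∑_{d ∣ P(z), d ≤ D} |R_d(x)|`.
Range of `s` (recorded from the sources): Friedlander–Iwaniec prove the two-sided bound with the
`β`-sieve of level `D` for `s ≥ 9κ + 1`, with the explicit constant `e^{9κ+1−s} K^{10}` (Lemma 6.8);
Halberstam–Richert Thm 2.5 give the stronger decay `exp(−s (log s − log log 3s − log κ − 2))` for
`s ≥ 1`. In the remaining bounded range `1 ≤ s ≤ 9κ + 1` the displayed bound (with a constant depending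
on `κ, K`) follows from `0 ≤ S(𝒜, z) ≤ S(𝒜, z₁)` for `z₁ ≤ z`, the upper-bound sieve
(Friedlander–Iwaniec Thm 6.9 / Thm 7.1) and `V(z₁) ≤ K (log z / log z₁)^κ V(z)`; hence the lemma is
stated for all `D ≥ z`, absorbing `e^{9κ+1}` into `C`. No positivity `0 < g(p)` is assumed
(Friedlander–Iwaniec §6 work with `0 ≤ g(p) < 1`, which is part of `HasSieveDimension`). [cite: FriedlanderIwaniecOpera2010, Lemma 6.8, Thm. 6.9 and Cor. 6.10] [cite: HalberstamRichert1974, Thm. 2.5 and Thm. 7.2] -/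
def SieveSequence.fundamental_lemma_uniform : Prop :=
  ∀ (κ K : ℝ),
    ∃ C : ℝ, 0 < C ∧ ∀ A : SieveSequence, HasSieveDimension A.density κ K →
      ∀ x z D : ℝ, 2 ≤ z → z ≤ D → 0 ≤ A.size x →
        |A.sifted x (primesProdBelow z) - A.size x * A.densityProduct (primesProdBelow z)| ≤
          C * A.size x * A.densityProduct (primesProdBelow z) *
              Real.exp (-(Real.log D / Real.log z)) +
            ∑ d ∈ (primesProdBelow z).divisors.filter (fun d : ℕ => (d : ℝ) ≤ D),
              |A.remainder d x|

/-- The **Fundamental Lemma** for a single sifted sequence `𝒜` of dimension `κ` (Friedlander–Iwaniec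
Cor 6.10; Halberstam–Richert Thm 2.5): there is `C > 0` with
`|S(𝒜, z; x) − X V(z)| ≤ C X V(z) e^{−log D / log z} + ∑_{d ∣ P(z), d ≤ D} |R_d(x)|` for all `x` and all
`2 ≤ z ≤ D` with `X(x) ≥ 0`. Immediate from the uniform form `fundamental_lemma_uniform` (whose
constant depends on `κ, K` only). [folklore] -/
def SieveSequence.fundamental_lemma : Prop :=
  ∀ (A : SieveSequence) (κ K : ℝ) (hA : HasSieveDimension A.density κ K),
    ∃ C : ℝ, 0 < C ∧ ∀ x z D : ℝ, 2 ≤ z → z ≤ D → 0 ≤ A.size x →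
      |A.sifted x (primesProdBelow z) - A.size x * A.densityProduct (primesProdBelow z)| ≤
        C * A.size x * A.densityProduct (primesProdBelow z) *
            Real.exp (-(Real.log D / Real.log z)) +
          ∑ d ∈ (primesProdBelow z).divisors.filter (fun d : ℕ => (d : ℝ) ≤ D),
            |A.remainder d x|

/- interim proof relied on results that are now named facts (D-0014); demoted to a fact by the M5 import, proof preserved:
:= by
  obtain ⟨C, hC, h⟩ := SieveSequence.fundamental_lemma_uniform κ K
  exact ⟨C, hC, h A hA⟩
-/

/-- The shifted primes `n ↦ Λ(n + h)`, `h` even, have sieve dimension `1` (Halberstam–Richert Ch. 2,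
Example / Lemma 2.4 with `κ = 1`; Friedlander–Iwaniec §5.5): their density is `g(p) = 1/(p − 1)` for
`p ∤ h` and `0` for `p ∣ h` (so `g(2) = 0` and `g(p) ≤ 1/2 < 1`), and by Mertens' theorem
`∏_{w ≤ p < z} (1 − 1/(p−1))⁻¹ ≤ K log z / log w`. For odd `h` the statement is false (`g(2) = 1`),
whence the parity hypothesis; `h = 0` is allowed (then `g = δ₁` trivially). [cite: HalberstamRichert1974, Ch. 2 Lemma 2.4 (κ = 1)] [cite: FriedlanderIwaniecOpera2010, §5.5] -/
def hasSieveDimension_shiftedPrimes_one : Prop :=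
  ∀ {h : ℕ} (he : Even h),
    ∃ K : ℝ, HasSieveDimension (SieveSequence.shiftedPrimes h).density 1 K

end Literature.NumberTheory.Sieve

/-! ### Selberg's `Λ²` sieve: `G(√D)` and the upper bound (dot-extension of Mathlib's `SelbergSieve`) -/

namespace SelbergSieve

/-- `S.selbergSum = G(√D) = ∑_{l ∣ P, l² ≤ D} g(l)` where `D = S.level` and `g = S.selbergTerms` is
Heath-Brown's multiplicative function `g(l) = ν(l) ∏_{p ∣ l} (1 − ν(p))⁻¹` (Heath-Brown, *Lectures on
sieves*, §3; Friedlander–Iwaniec (7.4) with `h(p) = g(p)/(1 − g(p))`, `J = G`). This is a deliberate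
dot-notation extension of Mathlib's `SelbergSieve` (the only level-dependent datum). [folklore] -/
noncomputable def selbergSum (S : SelbergSieve) : ℝ :=
  ∑ l ∈ S.prodPrimes.divisors.filter (fun l : ℕ => (l : ℝ) ^ 2 ≤ S.level), S.selbergTerms l

/-- `G(√D) > 0`: the term `l = 1` is present (`1 ≤ D`) and all terms are positive
(`BoundingSieve.selbergTerms_pos`). [folklore] -/
theorem selbergSum_pos (S : SelbergSieve) : 0 < S.selbergSum := by
  refine Finset.sum_pos (fun l hl => ?_) ⟨1, ?_⟩
  · exact BoundingSieve.selbergTerms_pos (Nat.dvd_of_mem_divisors (Finset.mem_filter.mp hl).1)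
  · simp only [Finset.mem_filter, Nat.one_mem_divisors, Nat.cast_one, one_pow]
    exact ⟨BoundingSieve.prodPrimes_ne_zero, S.one_le_level⟩

/-- **Selberg's `Λ²` upper-bound sieve** (Heath-Brown, *Lectures on sieves*, Thm 5 (the "fundamental
theorem" whose sum `S` is `selbergSum`); Friedlander–Iwaniec, *Opera de Cribro*, Thm 7.1;
Halberstam–Richert Thm 3.2): with level `D`,
`S(𝒜, P) ≤ X / G(√D) + ∑_{d ∣ P, d ≤ D} 3^{ω(d)} |R_d|`.
Obtained from Mathlib's `siftedSum_le_mainSum_errSum_of_upperMoebius` and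
`mainSum_lambdaSquared_eq_sum_mul_sum_sq` by the optimal choice of the `Λ²` weights supported on
`d ≤ √D` (main term exactly `X / G(√D)`) and the bound `|λ_d| ≤ 1`, `#{(d₁,d₂) : [d₁,d₂] = d} = 3^{ω(d)}`
for the error term. [cite: FriedlanderIwaniecOpera2010, Thm. 7.1] [cite: HalberstamRichert1974, Thm. 3.2] -/
def siftedSum_le_totalMass_div_selbergSum_add : Prop :=
  ∀ (S : SelbergSieve),
    S.siftedSum ≤ S.totalMass / S.selbergSum +
      ∑ d ∈ S.prodPrimes.divisors.filter (fun d : ℕ => (d : ℝ) ≤ S.level),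
        (3 : ℝ) ^ ω d * |S.rem d|

end SelbergSieve
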